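import Mathlib
import HarnessLib
import Summits.HubbardSuperconductivity.HubbardSuperconductivity.Theorems.KLProgrammeKLRegimeTwoVolumeTowerDataDefs
import Summits.HubbardSuperconductivity.HubbardSuperconductivity.Theorems.KLProgrammeKLRegimeTwoVolumeTowerBaseCanonical

/-!
# Route `KLProgramme` — crux K3, VL child `KLRegimeVolumeLimitV17F2` (stmt-HubbardSuperconductivity-20440), blueprint v5 M5: `TowerData β U μ` FROM ITS PARTS
# (seat hubbard-kl-k3c4-p1 g13; `--supports` 20440)

The one remaining data stub of the registered skeleton «cauchy» v9b is `Nonempty (TowerData β U μ)` under the regime (`stub_vl_towerData`).  This file is the flat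
constructor the dischargers call: its arguments are the fields (H1)–(H5) of `TowerData` VERBATIM (constants, budgets, recursion, smallness, mismatch rates, the
three per-step bundles eventually in `L`) and, in place of the radius fields `r, hr, hRd` and the base field `h0`, the DATA behind the base — the base-transfer
bundle of `…TowerBase`, the grid bundle `TowerGridData` (`…TowerBaseGridDataDefs`) at the canonical radii, and six rates tending to zero (`…TowerBaseCanonical`);
the radius is the canonical `r L = L / (4·n_β + 7)` (`…TowerGenericFacts`).  Grid-side constants carry a `g` after their first letter (`κg`, `ΛgT`, `sgE L`, …) to keep
them apart from the per-step families.

* **`towerData_of_parts`** — `Nonempty (TowerData β U μ)`.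

Proofs only; no definition.
-/

noncomputable section

namespace Summit.HubbardSuperconductivity.HubbardSuperconductivity.Theorems.TwoVolumeSource

set_option linter.dupNamespace false -- summit = problem name (single-conjunct summit), D-0017

open Finset Filter Topology Literature.MathematicalPhysics.QuantumLattice GrassmannAlgebra Literature.Probability.LatticeModels
  Literature.Probability.LatticeModels.BattleFederbush
open Literature.MathematicalPhysics.QuantumLattice.FermiRG
open Summit.HubbardSuperconductivity.HubbardSuperconductivity.Theorems.KLProgrammeLegKernels
open Summit.HubbardSuperconductivity.HubbardSuperconductivity.Theorems.KLRegimeSplit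
open Summit.HubbardSuperconductivity.HubbardSuperconductivity.Theorems.TwoPointAssembly
open Summit.HubbardSuperconductivity.HubbardSuperconductivity.Theorems.EngineV8
open Summit.HubbardSuperconductivity.HubbardSuperconductivity.Theorems.TwoVolumeDefect

/-- **`TowerData β U μ` FROM ITS PARTS** (see the module docstring): fields (H1)–(H5) verbatim, canonical radius, base from data. [folklore] -/
theorem towerData_of_parts (β U μ : ℝ) (hβ : 0 < β) (Mth : ℕ → ℕ → ℕ)
    (hMth : ∀ L b M, Mth L b ≤ M → 0 < imagTimeWeight β M ∧ imagTimeWeight β M ≤ 1)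
    -- (H1)–(H5): the fields of `TowerData` other than `Mth, r, hr, hRd, h0`, verbatim
    (Λ : ℕ → ℝ)
    (κ : ℕ → ℝ)
    (aW : ℕ → ℝ)
    (sW : ℕ → ℝ)
    (κ' : ℕ → ℝ)
    (aW' : ℕ → ℝ)
    (sW' : ℕ → ℝ)
    (eW' : ℕ → ℝ)
    (ΛT : ℕ → ℝ)
    (cW : ℕ → ℝ)
    (κf : ℕ → ℝ)
    (cRb : ℕ → ℝ)
    (cCb : ℕ → ℝ)
    (δb : ℕ → ℝ)
    (ρ₀ : ℕ → ℝ)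
    (ρf : ℕ → ℝ)
    (ρ₂ : ℕ → ℝ)
    (ρ' : ℕ → ℝ)
    (ρ₃ : ℕ → ℝ)
    (ν₀ : ℕ → ℝ)
    (ν₁ : ℕ → ℝ)
    (ν₂ : ℕ → ℝ)
    (ν₃ : ℕ → ℝ)
    (ν₄ : ℕ → ℝ)
    (ν₅ : ℕ → ℝ)
    (νE : ℕ → ℝ)
    (ν₆ : ℕ → ℝ)
    (ν₇ : ℕ → ℝ)
    (ν₈ : ℕ → ℝ)
    (NV : ℕ → ℕ → ℝ)
    (NS : ℕ → ℕ → ℝ)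
    (sE : ℕ → ℕ → ℝ)
    (cR : ℕ → ℕ → ℝ)
    (cC : ℕ → ℕ → ℝ)
    (δ : ℕ → ℕ → ℝ)
    (hΛ : ∀ j, 0 < Λ j)
    (hΛmono : ∀ j, Λ (j + 1) ≤ Λ j)
    (hΛT : ∀ j, Λ j ≤ ΛT j)
    (hκ : ∀ j, 0 < κ j ∧ 0 < κ' j ∧ 0 < κf j)
    (haW : ∀ j, 0 ≤ aW j ∧ 0 ≤ aW' j ∧ 0 ≤ sW j ∧ 0 ≤ sW' j ∧ 0 ≤ eW' j ∧ 0 ≤ cW j ∧ 0 ≤ δb j)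
    (hρ : ∀ j, 0 < ρ₀ j ∧ 0 < ρf j ∧ 0 < ρ₂ j ∧ 0 < ρ' j ∧ 0 < ρ₃ j)
    (hNV0 : ∀ j m, 0 ≤ NV j m)
    (hNSnn : ∀ j k, 0 ≤ NS j k)
    (hNS0 : ∀ k, NS 0 k = if Even k then NV 0 (k / 2) else 0)
    (hNSsucc : ∀ j k, j < nScales β → NS (j + 1) k = (ρ₀ j)⁻¹ ^ k * (Real.exp 1 * ν₀ j) / (1 - Real.exp 1 * aW j * ν₀ j / κ j ^ 2))
    (hsm : ∀ j, j < nScales β → TowerScaleSmall (κ j) (κ' j) (aW j) (aW' j) (cW j) (κf j) (cRb j) (cCb j) (δb j) (ρ₀ j) (ρf j) (ρ₂ j) (ρ' j) (ρ₃ j) (NV j) (NS j)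
      (ν₀ j) (ν₁ j) (ν₂ j) (ν₃ j) (ν₄ j) (ν₅ j) (νE j) (ν₆ j) (ν₇ j) (ν₈ j))
    (hmis : ∀ j L, 0 ≤ sE j L ∧ 0 ≤ cR j L ∧ 0 ≤ cC j L ∧ 0 ≤ δ j L ∧ cR j L ≤ cRb j ∧ cC j L ≤ cCb j ∧ δ j L ≤ δb j)
    (hmis0 : ∀ j, Tendsto (sE j) atTop (𝓝 0) ∧ Tendsto (cR j) atTop (𝓝 0) ∧ Tendsto (cC j) atTop (𝓝 0) ∧ Tendsto (δ j) atTop (𝓝 0))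
    (hdata : ∀ᶠ L in atTop, ∀ (b M : ℕ) [NeZero L] [NeZero (b * L)] [NeZero M], Mth L b ≤ M →
      TowerVolumeData L M β U μ (klFlowFrameU L M β U μ (nScales β + 1)) (nScales β) (imagTimeWeight β M) Λ κ aW sW NV ∧
      TowerVolumeData (b * L) M β U μ (klFlowFrameU (b * L) M β U μ (nScales β + 1)) (nScales β) (imagTimeWeight β M) Λ κ aW sW NV ∧
      TowerCrossData L b M β μ (klFlowFrameU L M β U μ (nScales β + 1)) (klFlowFrameU (b * L) M β U μ (nScales β + 1)) (nScales β) (imagTimeWeight β M)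
      Λ κ' aW' sW' eW' ΛT cW κf (fun j => sE j L) (fun j => cR j L) (fun j => cC j L) (fun j => δ j L))
    -- the base-transfer data of `…TowerBase`
    {ΛgT cgW Λg δgb : ℝ} (hgΛT : 0 < ΛgT) (hcW : 0 ≤ cgW) (hΛg : 0 < Λg) (NG : ℕ → ℝ) (hNG0 : ∀ k, 0 ≤ NG k)
    (δg : ℕ → ℝ) (hgδ : ∀ L, 0 ≤ δg L ∧ δg L ≤ δgb) (hgδ0 : Tendsto δg atTop (𝓝 0))
    (hdataT : ∀ᶠ L in atTop, ∀ (b M : ℕ) [NeZero L] [NeZero (b * L)] [NeZero M], Mth L b ≤ M →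
      (∀ x : SrcLabel (b * L) M 0, ∑ y, ‖klBaseTransfer (b * L) M β μ (klFlowFrameU L M β U μ (nScales β + 1)) x y‖ * (1 + ΛgT * (Torus.tnorm (x.1.1.2 - y.1.1.1.2) : ℝ)) ≤ cgW) ∧
      (∀ y : GridLeg (GridPoint (b * L) (klGridN M)) × Fin 2, ∑ x, ‖klBaseTransfer (b * L) M β μ (klFlowFrameU L M β U μ (nScales β + 1)) x y‖ * (1 + ΛgT * (Torus.tnorm (x.1.1.2 - y.1.1.1.2) : ℝ)) ≤ cgW) ∧
      (∀ (δ' β' β₁ : Fin 2 → Fin b) (xbar : SrcLabel L M 0) (y : GridLeg (GridPoint L (klGridN M)) × Fin 2),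
        ‖klBaseTransfer (b * L) M β μ (klFlowFrameU L M β U μ (nScales β + 1)) ((klBlockEquivD L b M 0).symm (β' + δ', xbar)) ((klGridBlockEquivD L b M).symm (β₁ + δ', y))‖ =
          ‖klBaseTransfer (b * L) M β μ (klFlowFrameU L M β U μ (nScales β + 1)) ((klBlockEquivD L b M 0).symm (β', xbar)) ((klGridBlockEquivD L b M).symm (β₁, y))‖) ∧
      (∀ x, ∑ y, ‖klBaseTransfer (b * L) M β μ (klFlowFrameU (b * L) M β U μ (nScales β + 1)) x y - klBaseTransfer (b * L) M β μ (klFlowFrameU L M β U μ (nScales β + 1)) x y‖ ≤ δg L) ∧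
      (∀ y, ∑ x, ‖klBaseTransfer (b * L) M β μ (klFlowFrameU (b * L) M β U μ (nScales β + 1)) x y - klBaseTransfer (b * L) M β μ (klFlowFrameU L M β U μ (nScales β + 1)) x y‖ ≤ δg L) ∧
      (∀ (k : ℕ) (p : Fin k) (y : GridLeg (GridPoint L (klGridN M))),
        ∑ Y ∈ univ.filter (fun Y : Fin k → GridLeg (GridPoint L (klGridN M)) => Y p = y),
          ‖kernel ℂ (klGridAction L M β U μ (klFlowFrameU L M β U μ (nScales β + 1))) k Y‖ *
            (1 + labelDiam (fun Y₁ Y₂ : GridLeg (GridPoint L (klGridN M)) => Λg * (Torus.tnorm (Y₁.1.1.2 - Y₂.1.1.2) : ℝ)) (univ.image Y)) ≤ imagTimeWeight β M * NG k) ∧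
      (∀ (k : ℕ) (p : Fin k) (y : GridLeg (GridPoint (b * L) (klGridN M))),
        ∑ Y ∈ univ.filter (fun Y : Fin k → GridLeg (GridPoint (b * L) (klGridN M)) => Y p = y),
          ‖kernel ℂ (klGridAction (b * L) M β U μ (klFlowFrameU (b * L) M β U μ (nScales β + 1))) k Y‖ *
            (1 + labelDiam (fun Y₁ Y₂ : GridLeg (GridPoint (b * L) (klGridN M)) => Λg * (Torus.tnorm (Y₁.1.1.2 - Y₂.1.1.2) : ℝ)) (univ.image Y)) ≤ imagTimeWeight β M * NG k))
    -- the grid data of `tower_base_grid_keyedDefect_eventually_le`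
    {κE αC cb κg κg' ρS ρg' ρg₂ ρgf αw α α' m₁ m₁' s s' Θ νW νf νg₂ νD : ℝ}
    (hκE : 0 < κE) (hαC : 0 < αC) (hgκ : 0 < κg) (hgκ' : 0 < κg') (hρS : 0 < ρS) (hgρ' : 0 < ρg') (hgρ₂ : 0 < ρg₂) (hgρf : 0 < ρgf) (hαw : 0 < αw)
    (hαα : 0 < α' + α) (hm0 : 0 ≤ m₁) (hm0' : 0 ≤ m₁') (hs0 : 0 ≤ s) (hs'0 : 0 ≤ s') (hνW0 : 0 ≤ νW) (hνf0 : 0 ≤ νf) (hν₂0 : 0 ≤ νg₂)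
    (hθS : Real.exp 1 * (αC + cb) * νW / κE ^ 2 < 1) (hθΘ : Real.exp 1 * αw * Θ / κg' ^ 2 < 1)
    (hθf : Real.exp 1 * (α' + α + (m₁' + m₁)) * νf / (κg' + κg) ^ 2 < 1) (hθ₂ : Real.exp 1 * (α' + α + (m₁' + m₁)) * νg₂ / (κg' + κg + (κg' + κg + (κg' + κg))) ^ 2 < 1)
    (sgE cgR cgC eE T Te : ℕ → ℝ)
    (hrate : ∀ L, 0 ≤ sgE L ∧ 0 ≤ cgR L ∧ 0 ≤ cgC L ∧ cgR L + cgC L ≤ cb ∧ 0 < T L ∧ 0 ≤ Te L)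
    (hsE0 : Tendsto sgE atTop (𝓝 0)) (hcR0 : Tendsto cgR atTop (𝓝 0)) (hcC0 : Tendsto cgC atTop (𝓝 0)) (heE0 : Tendsto eE atTop (𝓝 0))
    (hT0 : Tendsto T atTop (𝓝 0)) (hTe0 : Tendsto Te atTop (𝓝 0))
    (hgdata : ∀ᶠ L in atTop, ∀ (b M : ℕ) [NeZero L] [NeZero (b * L)] [NeZero M], Mth L b ≤ M →
      Nonempty (TowerGridData L b M β U μ (klFlowFrameU L M β U μ (nScales β + 1)) (klFlowFrameU (b * L) M β U μ (nScales β + 1)) (imagTimeWeight β M) κE αC κg κg' ρS ρg' ρg₂ ρgf αw α α' m₁ m₁' s s' Θ νW νf νg₂ νD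
        (sgE L) (cgR L) (cgC L) (eE L) (T L) (Te L) (Nat.sqrt (L / (4 * nScales β + 7))) ((L / (4 * nScales β + 7)) - Nat.sqrt (L / (4 * nScales β + 7)))))
 :
    Nonempty (TowerData β U μ) :=
  ⟨{
    Mth := Mth
    r := fun L => L / (4 * nScales β + 7)
    hr := tower_radius_tendsto β
    hRd := tower_radius_deep β
    Λ := Λ
    κ := κ
    aW := aW
    sW := sW
    κ' := κ'
    aW' := aW'
    sW' := sW'
    eW' := eW'
    ΛT := ΛT
    cW := cW
    κf := κf
    cRb := cRb
    cCb := cCb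
    δb := δb
    ρ₀ := ρ₀
    ρf := ρf
    ρ₂ := ρ₂
    ρ' := ρ'
    ρ₃ := ρ₃
    ν₀ := ν₀
    ν₁ := ν₁
    ν₂ := ν₂
    ν₃ := ν₃
    ν₄ := ν₄
    ν₅ := ν₅
    νE := νE
    ν₆ := ν₆
    ν₇ := ν₇
    ν₈ := ν₈
    NV := NV
    NS := NS
    sE := sE
    cR := cR
    cC := cC
    δ := δ
    hΛ := hΛ
    hΛmono := hΛmono
    hΛT := hΛT
    hκ := hκ
    haW := haW
    hρ := hρ
    hNV0 := hNV0
    hNSnn := hNSnn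
    hNS0 := hNS0
    hNSsucc := hNSsucc
    hsm := hsm
    hmis := hmis
    hmis0 := hmis0
    hdata := hdata
    h0 := towerData_h0_canonical β U μ hβ Mth hMth hgΛT hcW hΛg NG hNG0 δg hgδ hgδ0 hdataT hκE hαC hgκ hgκ' hρS hgρ' hgρ₂ hgρf hαw hαα hm0 hm0'
      hs0 hs'0 hνW0 hνf0 hν₂0 hθS hθΘ hθf hθ₂ sgE cgR cgC eE T Te hrate hsE0 hcR0 hcC0 heE0 hT0 hTe0 hgdata }⟩

end Summit.HubbardSuperconductivity.HubbardSuperconductivity.Theorems.TwoVolumeSource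

end
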